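import Summits.QuantumFields.BalabanUV.Beta.GAN24.CombBornBorderLineage
import Summits.QuantumFields.BalabanUV.Beta.GAN24.CombTransportPush
import Summits.QuantumFields.BalabanUV.Beta.GAN24.BornBorderLetters

/-!
# `BalabanUV.Beta.GAN24.CombBorderTransportPush` — row G-an2-4 ∕ (CONV-C), TRANSFER-III, the (III′) S-slot (b), born-V sector: **THE BORDER COMPANION OF road-P2 M.47
# `CombTransportPush`** — the two MIXED channels of a transported table `𝒯 V = κ u ↦ Ψ̂ᵀ ∘ slotPsiS r n V κ u ∘ Ψ̂` are identity-leg pushes through the corrector's field block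
# `ψ♭` of the RAW channels, hence **the (III′) one-step image of the V-source `combUnitStepMap Lc cE i (cVH • tabs.V)` reads the RAW border table through CONJUGATED one-step legs
# `legComp ψ♭ R_i` in its two field slots, the multiplier legs `colM ∕ rowMM K̃_i Lc` untouched — no `𝒯` is left at the birth level**
# (OWNER `b2b-balaban-gan24-p1` gen 55; the design line asked for by leaf-01 g89's `S-SLOT-LETTERS-SIZING-g89.md` §3∕§4(iv) and road-P2's `S-CAMPAIGN-SIZING-g56` v0.5 §2(b) ∕ v0.6)

NOT IN PRINT — OUR BOOKKEEPING ([folklore] kernel bookkeeping BY NAME, generic `d`; 0 `def`, 0 cited fact, 0 `def … : Prop`, 0 sorry).  Over: road-P2 M.47 `CombTransportPush`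
(`vertexW_psiKS_eq_slotPsiS`, `legDecay_psiKS`), M.56 `CombBornBorderLineage` (`combUnitStepMap_v_eq_two_push₃`: dressed legs `R_i` on the TRANSPORTED channels); leaf-01's `Push3 ∕ Push3Nest`
(`push₃_inl_inl`, `push₃_push₃`), `BornBorderLetters` (the Kronecker collapses `tsum_sum_mul_ite ∕ tsum_sum_ite_mul`); d1-leaf-03's `SymCorrectorKernel.psiKS_inl_inr ∕ _inr_inl ∕ _inr_inr`
(`Ψ̂`'s identity multiplier block, vanishing mixed blocks) and `SymCorrectorFace.slotPsiS_apply_kernel`; leaf-12's `RespStepSemigroup.respStep_self ∕ legComp_neg_right`; leaf-03's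
`SrecLinearPartEq` (`reslot`, `colM`, `rowMM`).
HONEST FRAMING (cell contract, verbatim): «discharging `BetaPertH` makes Bałaban's UV stability UNCONDITIONAL — a real constructive-QFT result; it is NOT the continuum limit
and NOT the Clay problem.»  HONEST DEPENDENCY (verbatim): «continuum YM on T⁴ ⇐ BetaPertH ∧ nine spine estimates (0/9 proved); BetaPertH ⇐ (D1) ∧ (D4) ∧ CAP+tail; G-an2-4
gates asym, D1 and NE2/3/4.»  IDENTITIES ONLY: discharges NO letter of road-P2 M.104 ∕ of the OWNER's END `CombChargeRowsOfBornContactLetters`; NO estimate, NO value ∕ rate of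
Bałaban's tables; NEVER «G-an2-4 closed» as (CONV-C); NOT D1, NOT BetaPertH, NOT continuum, NOT Clay.

## What is proved (generic `d`; `Ψ̂ = psiKS r n`, `ψ♭ α x κ u := Ψ̂ u x (inl κ) (inl α)` written inline — no `def`)
* §1 (`0 < n`, `r ∈ box (d+1) n`, ANY table `V`, no hypothesis on `V`) **`reslot_inl_inr_transport_eq_push₃`**:
  `reslot inl inr (κ u ↦ Ψ̂ᵀ ∘ slotPsiS r n V κ u ∘ Ψ̂) = push₃ ψ♭ (respStep 1 1) ψ♭ (reslot inl inr V)` and **`reslot_inr_inl_transport_eq_push₃`**: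
  `reslot inr inl (…) = push₃ (respStep 1 1) ψ♭ ψ♭ (reslot inr inl V)` — on a multiplier index the corrector is the Kronecker leg; on the slot it is `vertexW ψ♭`, on a field index
  `Lk ψ♭ ∕ Rk ψ♭` (M.47's mechanism `transport_eq_push₃_of_isFF`, one mixed channel at a time).
* §2 `legComp_respStep_self_left` (the identity response is a LEFT unit of `legComp`; leaf-03's `BornBorderContactBound.legComp_respStep_self` is the right-unit law),
  `legDecay_respStep_one` (it is a localised leg family at blocking `1`, at every rate).
* §3 (any `Lc ≥ 1`, any sym record `tabs : SymTables d Lc` with an off-diagonal border table, `hVff hVmm` displayed as in M.56) **`combUnitStepMap_v_eq_two_push₃_legComp`**: with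
  `ψ♭R_i := legComp ψ♭ (respStepBmSeq ρ_c Lc i)` (`ρ_c = ctr (d+1) Lc`, `Ψ̂ = psiKS (ctrOff (d+1) Lc) Lc`),
  `combUnitStepMap Lc cE i (cVH • tabs.V) = (cE·Lc^{2(d+1)}) • (−(push₃ (−ψ♭R_i) (colM K̃_i Lc) (ψ♭R_i) S + push₃ (rowMM K̃_i Lc) (ψ♭R_i) (ψ♭R_i) S′))`,
  `S = reslot inl inr (cVH • tabs.V)`, `S′ = reslot inr inl (cVH • tabs.V)` the RAW channels — M.56 ⨾ §1 ⨾ `push₃_push₃` ⨾ §2.  The (E) display `BornBorderLineage.unitStepMap_v_eq_two_push₃`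
  token for token with `respStepBm ρ ↦ legComp ψ♭ (respStepBmSeq ρ_c Lc ·)` and `vhSAt ρ ↦ tabs.V` — exactly as the Λ ∕ Wilson sectors read their sources (M.47 ∕ M.51).
Sequel: `CombBornBorderContactNest` (the lineage nests into the full conjugated chain; the (III′) V contact term in leaf-03's (E) shape).  2026-08-28; no existing file touched.
-/


noncomputable section

open Finset
open scoped BigOperators
open Literature.MathematicalPhysics.QuantumFieldTheory
open Literature.MathematicalPhysics.QuantumFieldTheory.Balaban1983to89
open Literature.MathematicalPhysics.QuantumFieldTheory.Balaban1983to89.Beta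
open ExpKernelCalculus (MKer Decays comp)
open AffineAveraging (Site box toSite)
open AveragingContoursRooted (ctr ctrOff ctrOff_mem_box)
open OneStepResolventKernel (Fib LocStencil)
open StepJetData (locStencil_smul)
open BalabanCompositeJets (respStep)
open Summit.QuantumFields.BalabanUV.Beta.TameKernelCalculus (trK trK_apply)
open Summit.QuantumFields.BalabanUV.Beta.AxialDressingRooted (one_le_of_neZero)
open Summit.QuantumFields.BalabanUV.Beta.SymCorrectorKernel (psiKS psiKS_inl_inl psiKS_inl_inr psiKS_inr_inl psiKS_inr_inr)
open Summit.QuantumFields.BalabanUV.Beta.SymCorrectorFace (slotPsiS slotPsiS_apply_kernel)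
open Summit.QuantumFields.BalabanUV.Beta.SymmetrisedStepJets (SymTables)
open Summit.QuantumFields.BalabanUV.Beta.GAN24.CombesThomas (KStepUnit)
open Summit.QuantumFields.BalabanUV.Beta.GAN24.Push4 (legComp legComp_apply vertexW IsFF)
open Summit.QuantumFields.BalabanUV.Beta.GAN24.Push4Bounds (LegDecay)
open Summit.QuantumFields.BalabanUV.Beta.GAN24.Push4Iter (LegFam legChain legChain_zero)
open Summit.QuantumFields.BalabanUV.Beta.GAN24.Push3 (push₃ push₃_inl_inl push₃_inr_left push₃_inr_right push₃_smul push₃_neg push₃_add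
  locStencil_push₃_mono)
open Summit.QuantumFields.BalabanUV.Beta.GAN24.Push3Nest (push₃_push₃ legDecay_mono)
open Summit.QuantumFields.BalabanUV.Beta.GAN24.AffineUnroll (transport)
open Summit.QuantumFields.BalabanUV.Beta.GAN24.RespStepSemigroup (respStep_self legComp_respStep legComp_neg_left legComp_neg_right)
open Summit.QuantumFields.BalabanUV.Beta.GAN24.RespStepBm (respStepBm legDecay_respStepBm_of_decays legDecay_neg_respStepBm_of_decays)
open Summit.QuantumFields.BalabanUV.Beta.GAN24.RespStepBmDecompPsi (legDecay_respStep_of_decays decays_KStepUnit_levels)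
open Summit.QuantumFields.BalabanUV.Beta.GAN24.RespStepBmDecompExact (respStepBmSeq respStepBmSeq_apply)
open Summit.QuantumFields.BalabanUV.Beta.GAN24.SrecLinearPartEq (colM rowMM reslot reslot_inl_inl reslot_inr_left reslot_inr_right legDecay_colM
  legDecay_rowMM locStencil_reslot)
open Summit.QuantumFields.BalabanUV.Beta.GAN24.BornBorderLetters (push₃_respStep_self isFF_twoPush tsum_sum_mul_ite tsum_sum_ite_mul)
open Summit.QuantumFields.BalabanUV.Beta.GAN24.CombTransportPush (vertexW_psiKS_eq_slotPsiS legDecay_psiKS)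
open Summit.QuantumFields.BalabanUV.Beta.GAN24.CombBornSector (combUnitStepMap legDecay_combLeg)
open Summit.QuantumFields.BalabanUV.Beta.GAN24.CombBornBorderLineage (combUnitStepMap_v_eq_two_push₃ isFF_combUnitStepMap_v isLoc_combUnitStepMap_v)

namespace Summit.QuantumFields.BalabanUV.Beta.GAN24.CombBorderTransportPush

variable {d : ℕ}

/-! ## §1 The two mixed channels of a transported table are identity-leg pushes through `ψ♭` of the raw channels -/

section Channels

variable {n : ℕ} (hn : 0 < n) {r : Fin (d + 1) → ℕ} (hr : r ∈ box (d + 1) n)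
include hn hr

/-- NOT IN PRINT; OUR BOOKKEEPING ([folklore]; generic `d`, `0 < n`, `r ∈ box (d+1) n`, ANY table `V`, no hypothesis on `V`).  **THE FIELD–MULTIPLIER CHANNEL OF THE
TRANSPORTED TABLE IS THE PUSH OF THE RAW CHANNEL THROUGH `ψ♭` IN THE SLOT AND IN THE LEFT LEG, THE IDENTITY IN THE RIGHT LEG**:
`reslot inl inr (κ u ↦ Ψ̂ᵀ ∘ slotPsiS r n V κ u ∘ Ψ̂) = push₃ ψ♭ (respStep 1 1) ψ♭ (reslot inl inr V)` — `Ψ̂ = psiKS r n` has the identity multiplier block and vanishing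
mixed blocks (`psiKS_inr_inr ∕ _inl_inr ∕ _inr_inl`), so on the multiplier index the right corrector is the Kronecker leg; the slot transport is `vertexW ψ♭` and the left
corrector is `Lk ψ♭` (road-P2 M.47 `CombTransportPush.vertexW_psiKS_eq_slotPsiS`).  The border companion of M.47's `transport_eq_push₃_of_isFF`. -/
theorem reslot_inl_inr_transport_eq_push₃ (V : Fin (d + 1) → Site (d + 1) → MKer (d + 1) (Fib d)) :
    reslot Sum.inl Sum.inr (fun κ u => comp (comp (trK (psiKS r n)) (slotPsiS r n V κ u)) (psiKS r n))
      = push₃ (fun α x κ u => psiKS r n u x (Sum.inl κ) (Sum.inl α)) (respStep (d := d) 1 1)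
          (fun α x κ u => psiKS r n u x (Sum.inl κ) (Sum.inl α)) (reslot Sum.inl Sum.inr V) := by
  funext κ u x' z' a b
  rcases a with α | μ
  · rcases b with β | ν
    · have hL : reslot Sum.inl Sum.inr (fun κ u => comp (comp (trK (psiKS r n)) (slotPsiS r n V κ u)) (psiKS r n)) κ u x' z' (Sum.inl α) (Sum.inl β)
          = ∑' y : Site (d + 1), ∑ κ₁ : Fin (d + 1), psiKS r n y x' (Sum.inl κ₁) (Sum.inl α) * slotPsiS r n V κ u y z' (Sum.inl κ₁) (Sum.inr β) := by
        rw [reslot_inl_inl]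
        show (∑' y, ∑ f, comp (trK (psiKS r n)) (slotPsiS r n V κ u) x' y (Sum.inl α) f * psiKS r n y z' f (Sum.inr β)) = _
        have h1 : ∀ y : Site (d + 1), (∑ f, comp (trK (psiKS r n)) (slotPsiS r n V κ u) x' y (Sum.inl α) f * psiKS r n y z' f (Sum.inr β))
            = ∑ μ : Fin (d + 1), comp (trK (psiKS r n)) (slotPsiS r n V κ u) x' y (Sum.inl α) (Sum.inr μ) * (if y = z' ∧ μ = β then (1 : ℝ) else 0) := by
          intro y
          rw [Fintype.sum_sum_type]
          simp only [psiKS_inl_inr, mul_zero, Finset.sum_const_zero, zero_add, psiKS_inr_inr]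
        rw [tsum_congr h1, tsum_sum_mul_ite (fun y μ => comp (trK (psiKS r n)) (slotPsiS r n V κ u) x' y (Sum.inl α) (Sum.inr μ)) z' β]
        show (∑' y, ∑ f, trK (psiKS r n) x' y (Sum.inl α) f * slotPsiS r n V κ u y z' f (Sum.inr β)) = _
        refine tsum_congr fun y => ?_
        rw [Fintype.sum_sum_type]
        simp only [trK_apply, psiKS_inr_inl, zero_mul, Finset.sum_const_zero, add_zero]
      have hR : push₃ (fun α x κ u => psiKS r n u x (Sum.inl κ) (Sum.inl α)) (respStep (d := d) 1 1)
            (fun α x κ u => psiKS r n u x (Sum.inl κ) (Sum.inl α)) (reslot Sum.inl Sum.inr V) κ u x' z' (Sum.inl α) (Sum.inl β)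
          = ∑' y : Site (d + 1), ∑ κ₁ : Fin (d + 1), psiKS r n y x' (Sum.inl κ₁) (Sum.inl α) * slotPsiS r n V κ u y z' (Sum.inl κ₁) (Sum.inr β) := by
        rw [push₃_inl_inl, vertexW_psiKS_eq_slotPsiS hn hr]
        simp only [respStep_self]
        rw [tsum_sum_mul_ite (fun z κ₂ => ∑' x : Site (d + 1), ∑ κ₁ : Fin (d + 1),
          psiKS r n x x' (Sum.inl κ₁) (Sum.inl α) * slotPsiS r n (reslot Sum.inl Sum.inr V) κ u x z (Sum.inl κ₁) (Sum.inl κ₂)) z' β]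
        refine tsum_congr fun y => Finset.sum_congr rfl fun κ₁ _ => ?_
        rw [slotPsiS_apply_kernel, slotPsiS_apply_kernel (S := V)]
        simp only [reslot_inl_inl]
      rw [hL, hR]
    · rw [reslot_inr_right, push₃_inr_right]
  · rw [reslot_inr_left, push₃_inr_left]

/-- NOT IN PRINT; OUR BOOKKEEPING ([folklore]; generic `d`, ANY table `V`).  **THE MULTIPLIER–FIELD CHANNEL OF THE TRANSPORTED TABLE**:
`reslot inr inl (κ u ↦ Ψ̂ᵀ ∘ slotPsiS r n V κ u ∘ Ψ̂) = push₃ (respStep 1 1) ψ♭ ψ♭ (reslot inr inl V)` (identity in the LEFT leg, `ψ♭` in the right leg and in the slot). -/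
theorem reslot_inr_inl_transport_eq_push₃ (V : Fin (d + 1) → Site (d + 1) → MKer (d + 1) (Fib d)) :
    reslot Sum.inr Sum.inl (fun κ u => comp (comp (trK (psiKS r n)) (slotPsiS r n V κ u)) (psiKS r n))
      = push₃ (respStep (d := d) 1 1) (fun α x κ u => psiKS r n u x (Sum.inl κ) (Sum.inl α))
          (fun α x κ u => psiKS r n u x (Sum.inl κ) (Sum.inl α)) (reslot Sum.inr Sum.inl V) := by
  funext κ u x' z' a b
  rcases a with α | μ
  · rcases b with β | ν
    · have hL : reslot Sum.inr Sum.inl (fun κ u => comp (comp (trK (psiKS r n)) (slotPsiS r n V κ u)) (psiKS r n)) κ u x' z' (Sum.inl α) (Sum.inl β)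
          = ∑' y : Site (d + 1), ∑ κ₂ : Fin (d + 1), slotPsiS r n V κ u x' y (Sum.inr α) (Sum.inl κ₂) * psiKS r n y z' (Sum.inl κ₂) (Sum.inl β) := by
        rw [reslot_inl_inl]
        show (∑' y, ∑ f, comp (trK (psiKS r n)) (slotPsiS r n V κ u) x' y (Sum.inr α) f * psiKS r n y z' f (Sum.inl β)) = _
        refine tsum_congr fun y => ?_
        rw [Fintype.sum_sum_type]
        simp only [psiKS_inr_inl, mul_zero, Finset.sum_const_zero, add_zero]
        refine Finset.sum_congr rfl fun κ₂ _ => ?_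
        congr 1
        show (∑' y₁, ∑ f, trK (psiKS r n) x' y₁ (Sum.inr α) f * slotPsiS r n V κ u y₁ y f (Sum.inl κ₂)) = _
        have h1 : ∀ y₁ : Site (d + 1), (∑ f, trK (psiKS r n) x' y₁ (Sum.inr α) f * slotPsiS r n V κ u y₁ y f (Sum.inl κ₂))
            = ∑ μ : Fin (d + 1), (if y₁ = x' ∧ μ = α then (1 : ℝ) else 0) * slotPsiS r n V κ u y₁ y (Sum.inr μ) (Sum.inl κ₂) := by
          intro y₁
          rw [Fintype.sum_sum_type]
          simp only [trK_apply, psiKS_inl_inr, zero_mul, Finset.sum_const_zero, zero_add, psiKS_inr_inr]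
        rw [tsum_congr h1, tsum_sum_ite_mul (fun y₁ μ => slotPsiS r n V κ u y₁ y (Sum.inr μ) (Sum.inl κ₂)) x' α]
      have hR : push₃ (respStep (d := d) 1 1) (fun α x κ u => psiKS r n u x (Sum.inl κ) (Sum.inl α))
            (fun α x κ u => psiKS r n u x (Sum.inl κ) (Sum.inl α)) (reslot Sum.inr Sum.inl V) κ u x' z' (Sum.inl α) (Sum.inl β)
          = ∑' y : Site (d + 1), ∑ κ₂ : Fin (d + 1), slotPsiS r n V κ u x' y (Sum.inr α) (Sum.inl κ₂) * psiKS r n y z' (Sum.inl κ₂) (Sum.inl β) := by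
        rw [push₃_inl_inl, vertexW_psiKS_eq_slotPsiS hn hr]
        simp only [respStep_self]
        refine tsum_congr fun y => Finset.sum_congr rfl fun κ₂ _ => ?_
        rw [tsum_sum_ite_mul (fun x κ₁ => slotPsiS r n (reslot Sum.inr Sum.inl V) κ u x y (Sum.inl κ₁) (Sum.inl κ₂)) x' α]
        rw [slotPsiS_apply_kernel, slotPsiS_apply_kernel (S := V)]
        simp only [reslot_inl_inl]
      rw [hL, hR]
    · rw [reslot_inr_right, push₃_inr_right]
  · rw [reslot_inr_left, push₃_inr_left]

end Channels

/-! ## §2 The identity leg: left unit of `legComp`, localised at blocking `1` -/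

/-- [folklore] **THE IDENTITY RESPONSE IS A LEFT UNIT OF `legComp`**: `legComp (respStep M M) r = r` (leaf-12's `respStep_self`; the companion of leaf-03's right-unit law
`BornBorderContactBound.legComp_respStep_self`). -/
theorem legComp_respStep_self_left (r' : LegFam d) (M : ℕ) [NeZero M] : legComp (respStep (d := d) M M) r' = r' := by
  funext μ y κ u
  rw [legComp_apply, tsum_eq_single u]
  · rw [Finset.sum_eq_single κ]
    · rw [respStep_self, if_pos ⟨rfl, rfl⟩, mul_one]
    · intro lam _ hne
      rw [respStep_self, if_neg (fun h => hne h.2.symm), mul_zero]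
    · intro h; exact absurd (Finset.mem_univ κ) h
  · intro v hv
    refine Finset.sum_eq_zero fun lam _ => ?_
    rw [respStep_self, if_neg (fun h => hv h.1.symm), mul_zero]

/-- [folklore] **THE IDENTITY RESPONSE AT BLOCKING `1` IS A LOCALISED LEG FAMILY AT EVERY RATE** (its only non-zero entries are the diagonal ones, of modulus `1`). -/
theorem legDecay_respStep_one (m : ℝ) : LegDecay (respStep (d := d) 1 1) 1 1 m := by
  intro μ y κ u
  rw [respStep_self]
  split_ifs with h
  · rw [h.1, Nat.cast_one, one_smul, sub_self, abs_one]
    have h0 : B12Sec2to5.l1 (0 : Fin (d + 1) → ℤ) = 0 := by simp [B12Sec2to5.l1]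
    rw [h0, mul_zero, Real.exp_zero, mul_one]
  · rw [abs_zero, one_mul]; exact (Real.exp_pos _).le


/-! ## §3 The (III′) one-step image of the V-source: CONJUGATED one-step legs on the RAW table -/

section Birth

variable {Lc : ℕ} [NeZero Lc] (tabs : SymTables d Lc) (hVff : ∀ κ u x y (α β : Fin (d + 1)), tabs.V κ u x y (Sum.inl α) (Sum.inl β) = 0)
  (hVmm : ∀ κ u x y (μ ν : Fin (d + 1)), tabs.V κ u x y (Sum.inr μ) (Sum.inr ν) = 0) (cE cVH : ℝ)
include hVff hVmm

/-- NOT IN PRINT; OUR BOOKKEEPING ([folklore]; generic `d`, any sym record with an off-diagonal border table).  **THE (III′) ONE-STEP IMAGE OF THE V-SOURCE READ ON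
THE RAW TABLE THROUGH CONJUGATED ONE-STEP LEGS**: with `ψ♭R_i := legComp ψ♭ (respStepBmSeq ρ_c Lc i)` (the conjugated dressed one-step leg at the centred root) and
`S := reslot inl inr (cVH • tabs.V)`, `S′ := reslot inr inl (cVH • tabs.V)` the RAW channels,
`combUnitStepMap Lc cE i (cVH • tabs.V) = c₃ • (−(push₃ (−ψ♭R_i) (colM K̃_i Lc) (ψ♭R_i) S + push₃ (rowMM K̃_i Lc) (ψ♭R_i) (ψ♭R_i) S′))`
— road-P2 M.56 `combUnitStepMap_v_eq_two_push₃` (dressed legs `R_i` on the TRANSPORTED channels) ⨾ §1 (each transported channel is an identity-leg push through `ψ♭` of the raw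
one) ⨾ leaf-01's `push₃_push₃` ⨾ §2 (the identity leg drops out of the multiplier slots).  NO `𝒯` IS LEFT: the birth-level transport sits in the two FIELD legs exactly as in
the Λ ∕ Wilson sectors (M.47), and the multiplier legs `colM ∕ rowMM K̃_i Lc` are untouched. -/
theorem combUnitStepMap_v_eq_two_push₃_legComp (i : ℕ) :
    combUnitStepMap Lc cE i (fun κ u => cVH • tabs.V κ u) = fun κ' u' =>
      (cE * (Lc : ℝ) ^ (2 * (d + 1))) •
        -(push₃ (-(legComp (fun α x κ u => psiKS (ctrOff (d + 1) Lc) Lc u x (Sum.inl κ) (Sum.inl α)) (respStepBmSeq (ctr (d + 1) Lc) Lc i))) (colM (KStepUnit (d := d) Lc i) Lc) (legComp (fun α x κ u => psiKS (ctrOff (d + 1) Lc) Lc u x (Sum.inl κ) (Sum.inl α)) (respStepBmSeq (ctr (d + 1) Lc) Lc i)) (reslot Sum.inl Sum.inr fun κ u => cVH • tabs.V κ u) κ' u'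
          + push₃ (rowMM (KStepUnit (d := d) Lc i) Lc) (legComp (fun α x κ u => psiKS (ctrOff (d + 1) Lc) Lc u x (Sum.inl κ) (Sum.inl α)) (respStepBmSeq (ctr (d + 1) Lc) Lc i)) (legComp (fun α x κ u => psiKS (ctrOff (d + 1) Lc) Lc u x (Sum.inl κ) (Sum.inl α)) (respStepBmSeq (ctr (d + 1) Lc) Lc i)) (reslot Sum.inr Sum.inl fun κ u => cVH • tabs.V κ u) κ' u') := by
  have hLc : 1 ≤ Lc := one_le_of_neZero Lc
  have hLc0 : 0 < Lc := hLc
  have hr : ctrOff (d + 1) Lc ∈ box (d + 1) Lc := ctrOff_mem_box hLc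
  obtain ⟨CK, mK, hmK, hK⟩ := decays_KStepUnit_levels (d := d) (Lc := Lc) i
  -- outer legs: one dressed step at the centred root (`ctr (d+1) Lc = toSite (ctrOff (d+1) Lc)` by `rfl`), blocking `Lc`, rate `mK`
  have hl₁ : LegDecay (-respStepBm (ctr (d + 1) Lc) Lc (Lc ^ i) (Lc ^ (i + 1))) Lc _ mK := legDecay_neg_respStepBm_of_decays hLc hr hK hmK.le
  have hw₁ : LegDecay (respStepBm (ctr (d + 1) Lc) Lc (Lc ^ i) (Lc ^ (i + 1))) Lc _ mK := legDecay_respStepBm_of_decays hLc hr hK hmK.le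
  have hc₁ : LegDecay (colM (KStepUnit (d := d) Lc i) Lc) Lc CK mK := legDecay_colM hK
  have hm₁ : LegDecay (rowMM (KStepUnit (d := d) Lc i) Lc) Lc CK mK := legDecay_rowMM hK
  -- inner legs: `ψ♭` and the identity response, blocking `1`, rate `1`
  obtain ⟨Cψ, hψ⟩ := legDecay_psiKS (d := d) hLc0 hr zero_le_one
  have hι : LegDecay (respStep (d := d) 1 1) 1 1 1 := legDecay_respStep_one 1
  -- the two raw channels are local stencil families
  obtain ⟨CV, hV1⟩ := tabs.hV 1 zero_le_one
  have hV : LocStencil (fun κ u => cVH • tabs.V κ u) _ 1 := locStencil_smul cVH hV1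
  have hS := locStencil_reslot hV Sum.inl Sum.inr
  have hS' := locStencil_reslot hV Sum.inr Sum.inl
  rw [combUnitStepMap_v_eq_two_push₃ tabs hVff hVmm cE cVH i, reslot_inl_inr_transport_eq_push₃ hLc0 hr, reslot_inr_inl_transport_eq_push₃ hLc0 hr]
  funext κ' u'
  rw [push₃_push₃ hl₁ hc₁ hw₁ hψ hι hψ hmK one_pos hS one_pos, push₃_push₃ hm₁ hw₁ hw₁ hι hψ hψ hmK one_pos hS' one_pos,
    legComp_neg_right, legComp_respStep_self_left, legComp_respStep_self_left, respStepBmSeq_apply]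

end Birth

end Summit.QuantumFields.BalabanUV.Beta.GAN24.CombBorderTransportPush

end
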